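import Mathlib
import HarnessLib
import Summits.KontsevichZagierPeriods.Zeta5Search.Denom.LineProfileShape

/-!
# The rung-A line profile and its shape at `ξ = 23/10` (rung-A decay, one-variable side)

HONEST FRAMING: systematic search; no irrationality claim unless certified.  This file proves
elementary real-analysis facts about an explicit function of one variable; no statement about
`ζ(2)`, `ζ(5)` or any linear form is made here.

Rung A is the first-tale point `(6,5,4,7 | 0,1,2,12)` of [Zudilin2014ZetaTwo, Remark 3] (cell
records `families/measure/FAMILY.md` §10, `families/denom/P15KERNEL.md` §3f, §9).  Seen from
`u = t − (5n+1) = (ξ − 5) n + iηn`, the rational function `R_A(t)` has the numerator blocks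
`(0, 6n]`, `(n, 5n]`, `(2n, 4n]` and the denominator block `(7n, 12n]`, so — with the generic
primitive `gPrim` of `Denom/LineProfile.lean` — its scaled line profile is
`profileA ξ η = profileA0 ξ η − 2π|η|`, `profileA0 ξ η = (gPrim η (ξ+1) − gPrim η (ξ−5))
+ (gPrim η ξ − gPrim η (ξ−4)) + (gPrim η (ξ−1) − gPrim η (ξ−3)) − (gPrim η (ξ+7) − gPrim η (ξ+2))
+ profileAConst`, `profileAConst = 5 log 5 − 6 log 6 − 4 log 4 − 2 log 2 + 7` (the P15 analogue
is `LineProfile.profile`).  On the line `ξ = 23/10` put `PA η = profileA (23/10) η` and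
`DA η = angleA (23/10) η − 2π` (`hasDerivAt_PA`).

* `DA_eq`: `DA = numLegsA − denAngleA − 2π`, six antitone legs `arctan (w/η)`,
  `w ∈ {33, 27, 23, 17, 13, 7}/10`, and `denAngleA η = arctan (93/(10η)) − arctan (43/(10η))
  = arctan (5η/(η² + 3999/100))` (`denAngleA_eq`), monotone on `(0, 6]` since `6² < 3999/100`.
* `DA_antitoneOn` (`PA` concave on `(0, 6]`), `DA_neg_of_ge` and `DA_le_neg_four` (`DA ≤ −4`
  on `[6, ∞)`: `arctan x ≤ x`, `12/6 + 4 < 2π`), `PA_tail` (`PA η ≤ PA 6 − 4 (η − 6)`, `η ≥ 6`).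
* `twoPoint`: if `0 < η₁ ≤ η₂ ≤ 6`, `0 ≤ DA η₁`, `DA η₂ ≤ 0` then
  `PA η ≤ PA η₁ + DA η₁ (η₂ − η₁)` for all `η > 0`;  `PA_eq`: `PA` as eight signed values
  `gPrim η (p/10)` plus `profileAConst − 2π|η|`.

The numerical instance (`η₁ = 0.9262`, `η₂ = 0.9264`; design optimum `η* = 0.92630835`,
`sup PA = −13.22912419`) is certified in `Denom/RungALineCertificate.lean`.
-/

noncomputable section

open Real Set

namespace Summit.KontsevichZagierPeriods.Zeta5Search.Denom.RungALineProfileShape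

open Summit.KontsevichZagierPeriods.Zeta5Search.Denom.LineProfile
open Summit.KontsevichZagierPeriods.Zeta5Search.Denom.LineProfileShape (arctan_div_anti)

/-! ## The rung-A profile (generic abscissa `ξ`) -/

/-- The factorial constant `5 log 5 − 6 log 6 − 4 log 4 − 2 log 2 + 7` of the rung-A
profile. -/
def profileAConst : ℝ :=
  5 * Real.log 5 - 6 * Real.log 6 - 4 * Real.log 4 - 2 * Real.log 2 + 7

/-- `profileA0 ξ η`: the `2π|η|`-free part of the rung-A line profile at abscissa `ξ` —
numerator blocks `(ξ+1 | ξ−5)`, `(ξ | ξ−4)`, `(ξ−1 | ξ−3)`, denominator block `(ξ+7 | ξ+2)`,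
and `profileAConst`. -/
def profileA0 (ξ η : ℝ) : ℝ :=
  (gPrim η (ξ + 1) - gPrim η (ξ - 5)) + (gPrim η ξ - gPrim η (ξ - 4))
    + (gPrim η (ξ - 1) - gPrim η (ξ - 3)) - (gPrim η (ξ + 7) - gPrim η (ξ + 2)) + profileAConst

/-- The rung-A line profile `profileA ξ η = profileA0 ξ η − 2π|η|`. -/
def profileA (ξ η : ℝ) : ℝ := profileA0 ξ η - 2 * Real.pi * |η|

/-- `angleA ξ η`: the `η`-derivative of `profileA0 ξ` (a signed sum of eight angles). -/
def angleA (ξ η : ℝ) : ℝ :=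
  (Real.arctan ((ξ + 1) / η) - Real.arctan ((ξ - 5) / η))
    + (Real.arctan (ξ / η) - Real.arctan ((ξ - 4) / η))
    + (Real.arctan ((ξ - 1) / η) - Real.arctan ((ξ - 3) / η))
    - (Real.arctan ((ξ + 7) / η) - Real.arctan ((ξ + 2) / η))

/-- `profileA0` is even in `η`. -/
theorem profileA0_neg_eta (ξ η : ℝ) : profileA0 ξ (-η) = profileA0 ξ η := by
  simp only [profileA0, gPrim_neg_eta]

/-- `profileA` is even in `η`. -/
theorem profileA_neg_eta (ξ η : ℝ) : profileA ξ (-η) = profileA ξ η := by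
  simp only [profileA, profileA0_neg_eta, abs_neg]

/-- `d/dη profileA0 ξ η = angleA ξ η` for `η ≠ 0`. -/
theorem hasDerivAt_profileA0_eta (ξ : ℝ) {η : ℝ} (hη : η ≠ 0) :
    HasDerivAt (fun η : ℝ => profileA0 ξ η) (angleA ξ η) η := by
  have h := fun w => hasDerivAt_gPrim_eta hη w
  have key := (((((h (ξ + 1)).sub (h (ξ - 5))).add ((h ξ).sub (h (ξ - 4)))).add
    ((h (ξ - 1)).sub (h (ξ - 3)))).sub ((h (ξ + 7)).sub (h (ξ + 2)))).add_const profileAConst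
  exact key

/-- `d/dη profileA ξ η = angleA ξ η − 2π` for `η > 0`. -/
theorem hasDerivAt_profileA_eta (ξ : ℝ) {η : ℝ} (hη : 0 < η) :
    HasDerivAt (fun η : ℝ => profileA ξ η) (angleA ξ η - 2 * Real.pi) η := by
  have habs : HasDerivAt (fun η : ℝ => 2 * Real.pi * |η|) (2 * Real.pi * 1) η := by
    refine ((hasDerivAt_id' η).congr_of_eventuallyEq ?_).const_mul (2 * Real.pi)
    filter_upwards [Ioi_mem_nhds hη] with x hx using abs_of_pos hx
  have key : HasDerivAt (fun η : ℝ => profileA0 ξ η - 2 * Real.pi * |η|)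
      (angleA ξ η - 2 * Real.pi * 1) η := (hasDerivAt_profileA0_eta ξ hη.ne').sub habs
  rw [mul_one] at key
  exact key

/-- `profileA ξ` is continuous on `(0, ∞)`. -/
theorem continuousOn_profileA (ξ : ℝ) : ContinuousOn (fun η : ℝ => profileA ξ η) (Ioi 0) :=
  fun _ hη => (hasDerivAt_profileA_eta ξ hη).continuousAt.continuousWithinAt

/-! ## The line `ξ = 23/10` -/

/-- `PA η = profileA (23/10) η`, the rung-A line profile on the line `ξ = 23/10`. -/
def PA (η : ℝ) : ℝ := profileA (23 / 10) η

/-- `DA η = angleA (23/10) η − 2π` (the derivative of `PA` on `(0, ∞)`). -/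
def DA (η : ℝ) : ℝ := angleA (23 / 10) η - 2 * Real.pi

/-- The six numerator legs `arctan (w/η)`, `w ∈ {33, 27, 23, 17, 13, 7}/10`. -/
def numLegsA (η : ℝ) : ℝ :=
  Real.arctan (33 / 10 / η) + Real.arctan (27 / 10 / η) + Real.arctan (23 / 10 / η)
    + Real.arctan (17 / 10 / η) + Real.arctan (13 / 10 / η) + Real.arctan (7 / 10 / η)

/-- The denominator angle `arctan (93/(10η)) − arctan (43/(10η))`. -/
def denAngleA (η : ℝ) : ℝ := Real.arctan (93 / 10 / η) - Real.arctan (43 / 10 / η)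

/-- `d/dη PA = DA` on `(0, ∞)`. -/
theorem hasDerivAt_PA {η : ℝ} (hη : 0 < η) : HasDerivAt PA (DA η) η :=
  hasDerivAt_profileA_eta (23 / 10) hη

/-- `DA = numLegsA − denAngleA − 2π`. -/
theorem DA_eq (η : ℝ) : DA η = numLegsA η - denAngleA η - 2 * Real.pi := by
  simp only [DA, angleA, numLegsA, denAngleA]
  have e1 : ((23 : ℝ) / 10 + 1) / η = 33 / 10 / η := by ring
  have e2 : ((23 : ℝ) / 10 - 5) / η = -(27 / 10 / η) := by ring
  have e3 : ((23 : ℝ) / 10 - 4) / η = -(17 / 10 / η) := by ring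
  have e4 : ((23 : ℝ) / 10 - 1) / η = 13 / 10 / η := by ring
  have e5 : ((23 : ℝ) / 10 - 3) / η = -(7 / 10 / η) := by ring
  have e6 : ((23 : ℝ) / 10 + 7) / η = 93 / 10 / η := by ring
  have e7 : ((23 : ℝ) / 10 + 2) / η = 43 / 10 / η := by ring
  rw [e1, e2, e3, e4, e5, e6, e7, Real.arctan_neg, Real.arctan_neg, Real.arctan_neg]
  ring

/-- `PA = (eight signed values of gPrim) + profileAConst − 2π|η|`. -/
theorem PA_eq (η : ℝ) : PA η =
    gPrim η (33 / 10) + gPrim η (27 / 10) + gPrim η (23 / 10) + gPrim η (17 / 10)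
      + gPrim η (13 / 10) + gPrim η (7 / 10) - gPrim η (93 / 10) + gPrim η (43 / 10)
      + profileAConst - 2 * Real.pi * |η| := by
  simp only [PA, profileA, profileA0]
  have e1 : gPrim η ((23 : ℝ) / 10 + 1) = gPrim η (33 / 10) := by norm_num
  have e2 : gPrim η ((23 : ℝ) / 10 - 5) = -gPrim η (27 / 10) := by
    rw [show ((23 : ℝ) / 10 - 5) = -(27 / 10) by norm_num, gPrim_neg]
  have e3 : gPrim η ((23 : ℝ) / 10 - 4) = -gPrim η (17 / 10) := by
    rw [show ((23 : ℝ) / 10 - 4) = -(17 / 10) by norm_num, gPrim_neg]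
  have e4 : gPrim η ((23 : ℝ) / 10 - 1) = gPrim η (13 / 10) := by norm_num
  have e5 : gPrim η ((23 : ℝ) / 10 - 3) = -gPrim η (7 / 10) := by
    rw [show ((23 : ℝ) / 10 - 3) = -(7 / 10) by norm_num, gPrim_neg]
  have e6 : gPrim η ((23 : ℝ) / 10 + 7) = gPrim η (93 / 10) := by norm_num
  have e7 : gPrim η ((23 : ℝ) / 10 + 2) = gPrim η (43 / 10) := by norm_num
  rw [e1, e2, e3, e4, e5, e6, e7]
  ring

/-- Closed form `denAngleA η = arctan (5η / (η² + 3999/100))` for `η > 0` (`Real.arctan_add`). -/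
theorem denAngleA_eq {η : ℝ} (hη : 0 < η) :
    denAngleA η = Real.arctan (5 * η / (η ^ 2 + 3999 / 100)) := by
  have hη' : η ≠ 0 := hη.ne'
  unfold denAngleA
  have hx : 0 < 93 / 10 / η := by positivity
  have hy : 0 < 43 / 10 / η := by positivity
  have h1 : (93 / 10 / η) * (-(43 / 10 / η)) < 1 := by nlinarith
  rw [sub_eq_add_neg, ← Real.arctan_neg, Real.arctan_add h1]
  congr 1
  have hD1 : (1 - 93 / 10 / η * -(43 / 10 / η)) ≠ 0 := by
    have : 0 < 1 - 93 / 10 / η * -(43 / 10 / η) := by nlinarith [mul_pos hx hy]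
    exact this.ne'
  have hD2 : η ^ 2 + 3999 / 100 ≠ 0 := by positivity
  rw [div_eq_div_iff hD1 hD2]
  field_simp
  ring

/-- `denAngleA` is monotone on `(0, 6]`. -/
theorem denAngleA_mono {s t : ℝ} (hs : 0 < s) (hst : s ≤ t) (ht : t ≤ 6) :
    denAngleA s ≤ denAngleA t := by
  rw [denAngleA_eq hs, denAngleA_eq (hs.trans_le hst)]
  apply Real.arctan_mono
  rw [div_le_div_iff₀ (by positivity) (by positivity)]
  have hst' : s * t ≤ 6 * 6 := mul_le_mul (hst.trans ht) ht (hs.le.trans hst) (by norm_num)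
  nlinarith [mul_nonneg (sub_nonneg.2 hst) (by linarith : (0 : ℝ) ≤ 3999 / 100 - s * t)]

/-- `DA` is antitone on `(0, 6]`. -/
theorem DA_antitoneOn {s t : ℝ} (hs : 0 < s) (hst : s ≤ t) (ht : t ≤ 6) : DA t ≤ DA s := by
  rw [DA_eq, DA_eq]
  have hd := denAngleA_mono hs hst ht
  have l1 := arctan_div_anti (33 / 10) (by norm_num) hs hst
  have l2 := arctan_div_anti (27 / 10) (by norm_num) hs hst
  have l3 := arctan_div_anti (23 / 10) (by norm_num) hs hst
  have l4 := arctan_div_anti (17 / 10) (by norm_num) hs hst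
  have l5 := arctan_div_anti (13 / 10) (by norm_num) hs hst
  have l6 := arctan_div_anti (7 / 10) (by norm_num) hs hst
  unfold numLegsA
  linarith

/-- `DA η < 0` for `η ≥ 6` (`arctan x ≤ x`, `12/6 < 2π`). -/
theorem DA_neg_of_ge {η : ℝ} (hη : 6 ≤ η) : DA η < 0 := by
  rw [DA_eq]
  have hη0 : 0 < η := by linarith
  have hden : 0 ≤ denAngleA η := by
    unfold denAngleA
    have : Real.arctan (43 / 10 / η) ≤ Real.arctan (93 / 10 / η) :=
      Real.arctan_mono (div_le_div_of_nonneg_right (by norm_num) hη0.le)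
    linarith
  have leg : ∀ c : ℝ, 0 ≤ c → Real.arctan (c / η) ≤ c / 6 := fun c hc =>
    (show Real.arctan (c / η) ≤ c / η from by
      have ht : (0:ℝ) ≤ c / η := div_nonneg hc hη0.le
      have h0 : 0 ≤ Real.arctan (c / η) := by simpa using Real.arctan_mono ht
      have h := Real.le_tan h0 (Real.arctan_lt_pi_div_two _)
      rwa [Real.tan_arctan] at h).trans
      (div_le_div_of_nonneg_left hc (by norm_num) hη)
  have l1 := leg (33 / 10) (by norm_num)
  have l2 := leg (27 / 10) (by norm_num)
  have l3 := leg (23 / 10) (by norm_num)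
  have l4 := leg (17 / 10) (by norm_num)
  have l5 := leg (13 / 10) (by norm_num)
  have l6 := leg (7 / 10) (by norm_num)
  unfold numLegsA
  nlinarith [Real.pi_gt_three]

/-- `DA η ≤ −4` for `η ≥ 6` (`arctan x ≤ x`, `12/6 + 4 < 2π`). -/
theorem DA_le_neg_four {η : ℝ} (hη : 6 ≤ η) : DA η ≤ -4 := by
  rw [DA_eq]
  have hη0 : 0 < η := by linarith
  have hden : 0 ≤ denAngleA η := by
    unfold denAngleA
    have : Real.arctan (43 / 10 / η) ≤ Real.arctan (93 / 10 / η) :=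
      Real.arctan_mono (div_le_div_of_nonneg_right (by norm_num) hη0.le)
    linarith
  have leg : ∀ c : ℝ, 0 ≤ c → Real.arctan (c / η) ≤ c / 6 := fun c hc =>
    (show Real.arctan (c / η) ≤ c / η from by
      have ht : (0:ℝ) ≤ c / η := div_nonneg hc hη0.le
      have h0 : 0 ≤ Real.arctan (c / η) := by simpa using Real.arctan_mono ht
      have h := Real.le_tan h0 (Real.arctan_lt_pi_div_two _)
      rwa [Real.tan_arctan] at h).trans
      (div_le_div_of_nonneg_left hc (by norm_num) hη)
  have l1 := leg (33 / 10) (by norm_num)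
  have l2 := leg (27 / 10) (by norm_num)
  have l3 := leg (23 / 10) (by norm_num)
  have l4 := leg (17 / 10) (by norm_num)
  have l5 := leg (13 / 10) (by norm_num)
  have l6 := leg (7 / 10) (by norm_num)
  unfold numLegsA
  linarith [Real.pi_gt_d2]

/-- Tail slope: `PA η ≤ PA 6 − 4 (η − 6)` for `η ≥ 6` (mean value theorem and `DA_le_neg_four`). -/
theorem PA_tail {η : ℝ} (hη : 6 ≤ η) : PA η ≤ PA 6 - 4 * (η - 6) := by
  rcases hη.eq_or_lt with h | hlt
  · rw [← h]
    simp
  have cont : ContinuousOn PA (Icc 6 η) :=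
    (continuousOn_profileA (23 / 10)).mono fun x hx => lt_of_lt_of_le (by norm_num) hx.1
  have deriv : ∀ x ∈ Ioo 6 η, HasDerivAt PA (DA x) x := fun x hx =>
    hasDerivAt_PA (lt_trans (by norm_num) hx.1)
  obtain ⟨ξ, hξ, hslope⟩ := exists_hasDerivAt_eq_slope PA DA hlt cont deriv
  have h4 : DA ξ ≤ -4 := DA_le_neg_four hξ.1.le
  rw [hslope, div_le_iff₀ (by linarith)] at h4
  linarith

/-- **Two-point tangent lemma.**  If `0 < η₁ ≤ η₂ ≤ 6`, `0 ≤ DA η₁` and `DA η₂ ≤ 0`, then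
`PA η ≤ PA η₁ + DA η₁ · (η₂ − η₁)` for every `η > 0`. -/
theorem twoPoint {η₁ η₂ : ℝ} (h1 : 0 < η₁) (h12 : η₁ ≤ η₂) (h2 : η₂ ≤ 6) (hD1 : 0 ≤ DA η₁)
    (hD2 : DA η₂ ≤ 0) {η : ℝ} (hη : 0 < η) : PA η ≤ PA η₁ + DA η₁ * (η₂ - η₁) := by
  have cont : ∀ a b : ℝ, 0 < a → ContinuousOn PA (Icc a b) := fun a b ha =>
    (continuousOn_profileA (23 / 10)).mono fun x hx => lt_of_lt_of_le ha hx.1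
  have diff : ∀ a b : ℝ, 0 < a → DifferentiableOn ℝ PA (interior (Icc a b)) :=
    fun a b ha x hx => by
      rw [interior_Icc] at hx
      exact (hasDerivAt_PA (ha.trans hx.1)).differentiableAt.differentiableWithinAt
  have der : ∀ x : ℝ, 0 < x → deriv PA x = DA x := fun x hx => (hasDerivAt_PA hx).deriv
  have h2pos : 0 < η₂ := h1.trans_le h12
  -- the tangent bound on `[η₁, y]` for `y ≤ η₂`
  have mid : ∀ y : ℝ, η₁ ≤ y → y ≤ η₂ → PA y - PA η₁ ≤ DA η₁ * (y - η₁) :=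
    fun y hy1 hy2 =>
    (convex_Icc η₁ y).image_sub_le_mul_sub_of_deriv_le (cont η₁ y h1) (diff η₁ y h1)
      (C := DA η₁)
      (fun x hx => by
        rw [interior_Icc] at hx
        rw [der x (h1.trans hx.1)]
        exact DA_antitoneOn h1 hx.1.le (by linarith [hx.2]))
      η₁ ⟨le_rfl, hy1⟩ y ⟨hy1, le_rfl⟩ hy1
  rcases le_total η η₁ with hle | hge
  · have mono : MonotoneOn PA (Icc η η₁) :=
      monotoneOn_of_deriv_nonneg (convex_Icc η η₁) (cont η η₁ hη) (diff η η₁ hη) fun x hx => by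
        rw [interior_Icc] at hx
        rw [der x (hη.trans hx.1)]
        exact hD1.trans (DA_antitoneOn (hη.trans hx.1) hx.2.le (h12.trans h2))
    have := mono ⟨le_rfl, hle⟩ ⟨hle, le_rfl⟩ hle
    nlinarith [mul_nonneg hD1 (sub_nonneg.2 h12)]
  · rcases le_total η η₂ with hle2 | hge2
    · have := mid η hge hle2
      nlinarith [mul_le_mul_of_nonneg_left (by linarith : η - η₁ ≤ η₂ - η₁) hD1]
    · have anti : AntitoneOn PA (Icc η₂ η) :=
        antitoneOn_of_deriv_nonpos (convex_Icc η₂ η) (cont η₂ η h2pos) (diff η₂ η h2pos)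
          fun x hx => by
            rw [interior_Icc] at hx
            rw [der x (h2pos.trans hx.1)]
            rcases le_or_gt x 6 with hx13 | hx13
            · exact (DA_antitoneOn h2pos hx.1.le hx13).trans hD2
            · exact (DA_neg_of_ge hx13.le).le
      have hA := anti ⟨le_rfl, hge2⟩ ⟨hge2, le_rfl⟩ hge2
      have := mid η₂ h12 le_rfl
      linarith

end Summit.KontsevichZagierPeriods.Zeta5Search.Denom.RungALineProfileShape

end
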